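import Literature.NumberTheory.EllipticCurves.PointCountEulerCriterion
import Summits.BirchSwinnertonDyer.Rank1Residual.X10.CasselsTatePairingGram
import Summits.BirchSwinnertonDyer.Rank1Residual.X11b.ChaPairsMinimality
import Summits.BirchSwinnertonDyer.Rank1Residual.Supersingular.DescentLowerBound
import Summits.BirchSwinnertonDyer.BirchSwinnertonDyer.Theorems.Rank1ResidualX11RankOneReduction
import HarnessLib

/-!
# X10b at `p = 3`, rank `0`, `ord₃ #Ш_an = 2`: per-pair KERNEL RECORDS of the Cassels–Tate-pairing (CTP-on-Sel³) certificate shape, every Galois / minimality hypothesis decided from the literal model (cell `b2b-bsdres`, unit `b2b-bsdres-x10`, gen 12)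

HONEST FRAMING (run/shared/lean/b2b/bsd-rank1-residual/, verbatim in every file): the goal of the
cell is to DELETE the COMBINATION-SHAPED residual classes of the Birch–Swinnerton-Dyer formula for
ALL analytic-rank `≤ 1` elliptic curves over `ℚ` — "full BSD formula for every rank `≤ 1` curve in
class `C`" assembled STRICTLY from published theorems — so that the rank-`≤ 1` remainder becomes
exactly the CONSTRUCTION-SHAPED classes, which are TYPED (missing-input `Prop`s), NOT attempted.
This is not "finishing BSD". Theorems only (no definition, no new named fact); NOTHING IS BOOKED
HERE; no class label changes (X10b stays CONSTRUCTION-SHAPED, referee R82.3 / R106.7). Per pair.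

**What this file is.** The companion `CasselsTatePairingGram.lean` (gen 10, p229476) proves, for an
ARBITRARY bi-additive pairing `B` on `Ш(E/ℚ)` with the printed Gram shape `[0 g; g′ 0]` (`g, g′ ≠ 0`)
on two `3`-torsion classes, together with `#Sel^(3)(E/ℚ) = 9`, `r_an = 0`, `ord₃ #Ш_an = 2` and
`ClassX10 W 3`, that `BSD(E,3)` holds (`X10.bsdp_three_rankZero_of_ctpGram_of_card_selmerThree`).
Here the SAME combination is delivered for LITERAL Cremona models with NO class hypothesis: the generic
consumer `bsdp_three_of_ainvs_of_ctpGram` takes an integral model `[a₁,…,a₆]` of a globally minimal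
`W` and DECIDES in the kernel that `E[3]` is irreducible — a good prime `ℓ ≠ 3` with kernel point count
`#Ẽ(𝔽_ℓ) = n` and `X² − (ℓ+1−n)X + ℓ` root-free mod `3` (Mazur 1978 Prop. 6.3 (1); tree
`IntModel.hasIrreducibleModPGaloisRep_of_intModel_of_noroot`, x11c's toolkit) — whence
`3 ∤ #E(ℚ)_tors` (`Supersingular.not_dvd_torsionOrder_of_irr`), and applies p229476's class-free
`bsdp_of_ctpGram_of_card_selmerGroup`; per record the kernel also decides `Δ ≠ 0` and GLOBAL
MINIMALITY of Cremona's model (Kraus 1989 / Silverman VII Rem. 1.1, tree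
`isGloballyMinimal_of_krausCriterion_bounded₂`). The fourteen records (six in this file, eight in the
companion `CasselsTatePairingRecordsB.lean`) are EXACTLY the fourteen ctp-sel3/1.1 TARGET DOCUMENTS OF RECORD of the cell's CTP-on-Sel³ instrument (route A = this unit,
gens 8–11; `HOME/b2b-bsdres-x10/g10/ctp-sel3/certs/README.md`): every rank-`0` `3Ns` (normaliser of
split Cartan at `3`) X10b class with `#Ш_an = 9` below conductor `5·10⁵`, `T1 = 340186p1` first.

**Status of the displayed binders (read this before citing a record).** In each record the binders are:
`hGZK` (Gross–Zagier–Kolyvagin, published); `hr : r_an = 0` and `ord₃ #Ш_an = 2` (Cremona / the cell's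
engines); `hcard : #Sel^(3)(E/ℚ) = 9` (the cell's two exact `3`-descent engines, x10b `desc3ns` +
x11b engine 1, `HOME/b2b-bsdres-x10/g10/ctp-sel3/T2-BATCH-G10.md`); and the PAIRING binders
`B, x₁, x₂, h₁₁, h₂₂, h₁₂, h₂₁` = "the Cassels–Tate pairing `⟨·,·⟩` on `Ш(E/ℚ)` (Cassels 1962, tree
`exists_casselsTate_pairing`) has Gram matrix `[0 g; g′ 0]`, `g, g′ ≠ 0`, on the images of the certified
Selmer basis `η₁, η₂`" — i.e. PRECISELY the content of the ctp-sel3/1.1 target document of that curve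
(the identification "printed matrix = Gram matrix of `⟨·,·⟩`" being Fisher–Newton 2014 Thm. 1.3 with
Cassels 1998 §1). AT THE TIME OF WRITING (2026-08-21) those fourteen documents carry route A's matrix
ONLY: verifier B (engines `ctpB`) has NOT read any of them — engines RULINGS R-281(d) (2026-08-21T01:58Z)
authorises B to read them (T1 first) once the gen-12 mutant suite is swept; regression state: R1′ + R3×3
+ R4 green at B, R1 (FN 17127b1) reproduced by route A only, R2 (Creutz 15675f1) outstanding (octic
path). The cell referee's ruling R106.7 (verifier B's verdict + regression + normalisation write-up +
binder discharge, the last two done) governs any per-pair BOOKING; these theorems book nothing — they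
make the booking, if and when the referee signs it, a one-line instantiation, and they record the
kernel-decided side facts (irreducibility witness, minimality, `Δ ≠ 0`) per curve now.

References: J. W. S. Cassels 1962 / 1998 §1 [Cassels1998]; T. Fisher, R. Newton, IJNT 10 (2014) Thm. 1.3
[FisherNewton2014]; R. L. Miller, LMS J. Comput. Math. 14 (2011) Def. 1.1 [Miller2011LMS]; B. Mazur,
Invent. Math. 44 (1978) Prop. 6.3 (1) [Mazur1978]; A. Kraus, Manuscripta Math. 65 (1989) [Kraus1989];
Silverman AEC Thm. X.4.2, VII Rem. 1.1 [SilvermanAEC2009]; J. E. Cremona, tables [Cremona2006]; cell files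
X10-AUDIT.md §13–§18, `HOME/b2b-bsdres-x10/g10/ctp-sel3/{FORMAT-1.1.md, T2-BATCH-G10.md, certs/}`,
`g12/ctp-sel3/FORMAT-1.1.md` (r3), engines RULINGS R-215(c), R-281(d).
-/

set_option autoImplicit false

noncomputable section

open scoped Classical

open WeierstrassCurve Literature.NumberTheory.EllipticCurves
  Literature.NumberTheory.EllipticCurves.Rank1Residual
  Literature.NumberTheory.EllipticCurves.Rank1Residual.Typed
  Literature.NumberTheory.EllipticCurves.Rank1Residual.X11RankOneCertificates
  Summit.BirchSwinnertonDyer.BirchSwinnertonDyer.Rank1Residual.IntModel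
  Summit.BirchSwinnertonDyer.BirchSwinnertonDyer.Rank1Residual.X11RankOne
  Summit.BirchSwinnertonDyer.Rank1Residual.X11b

namespace Summit.BirchSwinnertonDyer.Rank1Residual.X10

/-! ### §1. The record shape for a literal integer model (class-free; `E[3]` irreducible kernel-decided) -/

/-- **`BSD(E,3)` from the literal model + the CTP certificate shape.** For a globally minimal `W` with
integral model `[a₁,…,a₆]`: a good prime `ℓ ≠ 3` with `#Ẽ(𝔽_ℓ) = n` and `X² − (ℓ+1−n)X + ℓ` root-free
mod `3` gives `E[3]` irreducible (Mazur), hence `3 ∤ #E(ℚ)_tors`; with `r_an = 0`, `#Sel^(3)(E/ℚ) = 9`,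
a bi-additive pairing on `Ш(E/ℚ)` with Gram shape `[0 g; g′ 0]` (`g, g′ ≠ 0`) on two `3`-torsion classes
and `ord₃ #Ш_an = 2`, p229476's `bsdp_of_ctpGram_of_card_selmerGroup` gives `BSD(E,3)`. Per pair; not a
class theorem; books nothing. [cite: Miller2011LMS, Def. 1.1] [cite: FisherNewton2014, Thm. 1.3]
[cite: Mazur1978, §6 Prop. 6.3 (1) (p. 153)] [cite: SilvermanAEC2009, Thm X.4.2(a)] -/
theorem bsdp_three_of_ainvs_of_ctpGram
    (hGZK : rank_eq_analyticRank_of_analyticRank_le_one)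
    (a1 a2 a3 a4 a6 : ℤ) {W : WeierstrassCurve ℚ} [W.IsElliptic] [W.IsGloballyMinimal]
    (hW : integralModelInt W = ⟨a1, a2, a3, a4, a6⟩) (ℓ n : ℕ) [Fact ℓ.Prime]
    (hℓ3 : ℓ ≠ 3) (hℓΔ : ¬ (ℓ : ℤ) ∣ discOf [a1, a2, a3, a4, a6])
    (hcnt : Nat.card (((⟨a1, a2, a3, a4, a6⟩ : WeierstrassCurve ℤ).map
      (Int.castRingHom (ZMod ℓ))).toAffine.Point) = n)
    (hnoroot : ∀ t : ℕ, t < 3 → ¬ (3 : ℤ) ∣ (t : ℤ) ^ 2 - ((ℓ : ℤ) + 1 - n) * t + ℓ)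
    (hr : W.analyticRank = 0) (hcard : Nat.card (W.selmerGroup (3 : ℤ)) = 9)
    {Q : Type*} [AddCommGroup Q] (B : W.sha →+ W.sha →+ Q) {x₁ x₂ : W.sha}
    (hx₁ : 3 • x₁ = 0) (hx₂ : 3 • x₂ = 0)
    (h₁₁ : B x₁ x₁ = 0) (h₂₂ : B x₂ x₂ = 0) (h₁₂ : B x₁ x₂ ≠ 0) (h₂₁ : B x₂ x₁ ≠ 0)
    {q : ℚ} (hq : shaAn W = (q : ℂ)) (hv : padicValRat 3 q = 2) : BSDp W 3 := by
  haveI : Fact (Nat.Prime 3) := ⟨by norm_num⟩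
  have hΔ : (⟨a1, a2, a3, a4, a6⟩ : WeierstrassCurve ℤ).Δ = discOf [a1, a2, a3, a4, a6] :=
    intCurve_Δ a1 a2 a3 a4 a6
  have hirr : Irr W 3 := by
    refine hasIrreducibleModPGaloisRep_of_intModel_of_noroot hW 3 ℓ hℓ3 (by rw [hΔ]; exact hℓΔ) hcnt
      (forall_zmod_of_forall_lt fun t ht h0 ↦ hnoroot t ht ?_)
    change ((3 : ℕ) : ℤ) ∣ _
    rw [← ZMod.intCast_zmod_eq_zero_iff_dvd]
    push_cast at h0 ⊢
    linear_combination h0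
  exact bsdp_of_ctpGram_of_card_selmerGroup W 3 hGZK hr
    (Supersingular.not_dvd_torsionOrder_of_irr W 3 hirr)
    (by rw [show (3 : ℕ) ^ 2 = 9 by norm_num]; exact hcard) B hx₁ hx₂ h₁₁ h₂₂ h₁₂ h₂₁ hq hv

/-- **The exact `3`-part under the same data, no analytic `Ш` value needed: `ord₃ #Ш(E/ℚ) = 2`**
(`#Ш(E/ℚ)[3^∞] = 9`). [cite: FisherNewton2014, Thm. 1.3] [cite: Mazur1978, §6 Prop. 6.3 (1) (p. 153)]
[cite: SilvermanAEC2009, Thm X.4.2(a)] -/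
theorem padicValNat_shaOrder_three_eq_two_of_ainvs_of_ctpGram
    (hGZK : rank_eq_analyticRank_of_analyticRank_le_one)
    (a1 a2 a3 a4 a6 : ℤ) {W : WeierstrassCurve ℚ} [W.IsElliptic] [W.IsGloballyMinimal]
    (hW : integralModelInt W = ⟨a1, a2, a3, a4, a6⟩) (ℓ n : ℕ) [Fact ℓ.Prime]
    (hℓ3 : ℓ ≠ 3) (hℓΔ : ¬ (ℓ : ℤ) ∣ discOf [a1, a2, a3, a4, a6])
    (hcnt : Nat.card (((⟨a1, a2, a3, a4, a6⟩ : WeierstrassCurve ℤ).map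
      (Int.castRingHom (ZMod ℓ))).toAffine.Point) = n)
    (hnoroot : ∀ t : ℕ, t < 3 → ¬ (3 : ℤ) ∣ (t : ℤ) ^ 2 - ((ℓ : ℤ) + 1 - n) * t + ℓ)
    (hr : W.analyticRank = 0) (hcard : Nat.card (W.selmerGroup (3 : ℤ)) = 9)
    {Q : Type*} [AddCommGroup Q] (B : W.sha →+ W.sha →+ Q) {x₁ x₂ : W.sha}
    (hx₁ : 3 • x₁ = 0) (hx₂ : 3 • x₂ = 0)
    (h₁₁ : B x₁ x₁ = 0) (h₂₂ : B x₂ x₂ = 0) (h₁₂ : B x₁ x₂ ≠ 0) (h₂₁ : B x₂ x₁ ≠ 0) :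
    padicValNat 3 W.shaOrder = 2 := by
  haveI : Fact (Nat.Prime 3) := ⟨by norm_num⟩
  have hΔ : (⟨a1, a2, a3, a4, a6⟩ : WeierstrassCurve ℤ).Δ = discOf [a1, a2, a3, a4, a6] :=
    intCurve_Δ a1 a2 a3 a4 a6
  have hirr : Irr W 3 := by
    refine hasIrreducibleModPGaloisRep_of_intModel_of_noroot hW 3 ℓ hℓ3 (by rw [hΔ]; exact hℓΔ) hcnt
      (forall_zmod_of_forall_lt fun t ht h0 ↦ hnoroot t ht ?_)
    change ((3 : ℕ) : ℤ) ∣ _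
    rw [← ZMod.intCast_zmod_eq_zero_iff_dvd]
    push_cast at h0 ⊢
    linear_combination h0
  exact padicValNat_shaOrder_eq_two_of_ctpGram W 3 hGZK hr
    (Supersingular.not_dvd_torsionOrder_of_irr W 3 hirr)
    (by rw [show (3 : ℕ) ^ 2 = 9 by norm_num]; exact hcard) B hx₁ hx₂ h₁₁ h₂₂ h₁₂ h₂₁

/-! ### §2. Frobenius point-count witnesses for irreducibility of `E[3]` (kernel-decided data) -/
/-- `#Ẽ(𝔽_{13}) = 8` (`a_{13} = 6`; `X² − 6X + 13` is root-free mod `3`) for Cremona's model `340186p1` (kernel count). [folklore] -/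
theorem card_t340186p1_13 :
    Nat.card (((⟨1, 0, 0, -13183358, -18680240740⟩ : WeierstrassCurve ℤ).map (Int.castRingHom (ZMod 13))).toAffine.Point) = 8 := by
  rw [@WeierstrassCurve.natCard_point_eq_one_add_card (ZMod 13) (@ZMod.instField 13 ⟨by norm_num⟩) _ _ _
    (by decide +kernel), @card_sol_eq_sum_euler (ZMod 13) (@ZMod.instField 13 ⟨by norm_num⟩) _ _
    (by rw [ZMod.ringChar_zmod_n]; decide), ZMod.card]
  decide +kernel

/-- `#Ẽ(𝔽_{7}) = 5` (`a_{7} = 3`; `X² − 3X + 7` is root-free mod `3`) for Cremona's model `10082b1` (kernel count). [folklore] -/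
theorem card_t10082b1_7 :
    Nat.card (((⟨1, 0, 1, -708366, -227675928⟩ : WeierstrassCurve ℤ).map (Int.castRingHom (ZMod 7))).toAffine.Point) = 5 := by
  rw [@WeierstrassCurve.natCard_point_eq_one_add_card (ZMod 7) (@ZMod.instField 7 ⟨by norm_num⟩) _ _ _
    (by decide +kernel), @card_sol_eq_sum_euler (ZMod 7) (@ZMod.instField 7 ⟨by norm_num⟩) _ _
    (by rw [ZMod.ringChar_zmod_n]; decide), ZMod.card]
  decide +kernel

/-- `#Ẽ(𝔽_{31}) = 32` (`a_{31} = 0`; `X² + 31` is root-free mod `3`) for Cremona's model `40898d1` (kernel count). [folklore] -/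
theorem card_t40898d1_31 :
    Nat.card (((⟨1, 0, 1, -7249597, -7544452368⟩ : WeierstrassCurve ℤ).map (Int.castRingHom (ZMod 31))).toAffine.Point) = 32 := by
  rw [@WeierstrassCurve.natCard_point_eq_one_add_card (ZMod 31) (@ZMod.instField 31 ⟨by norm_num⟩) _ _ _
    (by decide +kernel), @card_sol_eq_sum_euler (ZMod 31) (@ZMod.instField 31 ⟨by norm_num⟩) _ _
    (by rw [ZMod.ringChar_zmod_n]; decide), ZMod.card]
  decide +kernel

/-- `#Ẽ(𝔽_{7}) = 5` (`a_{7} = 3`; `X² − 3X + 7` is root-free mod `3`) for Cremona's model `53966a1` (kernel count). [folklore] -/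
theorem card_t53966a1_7 :
    Nat.card (((⟨1, 1, 0, -343191, -77988907⟩ : WeierstrassCurve ℤ).map (Int.castRingHom (ZMod 7))).toAffine.Point) = 5 := by
  rw [@WeierstrassCurve.natCard_point_eq_one_add_card (ZMod 7) (@ZMod.instField 7 ⟨by norm_num⟩) _ _ _
    (by decide +kernel), @card_sol_eq_sum_euler (ZMod 7) (@ZMod.instField 7 ⟨by norm_num⟩) _ _
    (by rw [ZMod.ringChar_zmod_n]; decide), ZMod.card]
  decide +kernel

/-- `#Ẽ(𝔽_{13}) = 8` (`a_{13} = 6`; `X² − 6X + 13` is root-free mod `3`) for Cremona's model `55696l1` (kernel count). [folklore] -/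
theorem card_t55696l1_13 :
    Nat.card (((⟨0, 1, 0, 9105136, -14983896556⟩ : WeierstrassCurve ℤ).map (Int.castRingHom (ZMod 13))).toAffine.Point) = 8 := by
  rw [@WeierstrassCurve.natCard_point_eq_one_add_card (ZMod 13) (@ZMod.instField 13 ⟨by norm_num⟩) _ _ _
    (by decide +kernel), @card_sol_eq_sum_euler (ZMod 13) (@ZMod.instField 13 ⟨by norm_num⟩) _ _
    (by rw [ZMod.ringChar_zmod_n]; decide), ZMod.card]
  decide +kernel

/-- `#Ẽ(𝔽_{13}) = 11` (`a_{13} = 3`; `X² − 3X + 13` is root-free mod `3`) for Cremona's model `55696n1` (kernel count). [folklore] -/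
theorem card_t55696n1_13 :
    Nat.card (((⟨0, 1, 0, -2396088, -1642476716⟩ : WeierstrassCurve ℤ).map (Int.castRingHom (ZMod 13))).toAffine.Point) = 11 := by
  rw [@WeierstrassCurve.natCard_point_eq_one_add_card (ZMod 13) (@ZMod.instField 13 ⟨by norm_num⟩) _ _ _
    (by decide +kernel), @card_sol_eq_sum_euler (ZMod 13) (@ZMod.instField 13 ⟨by norm_num⟩) _ _
    (by rw [ZMod.ringChar_zmod_n]; decide), ZMod.card]
  decide +kernel

/-! ### §3. The records — six of the fourteen ctp-sel3/1.1 target documents of record here (`T1 = 340186p1` first), the other eight in `CasselsTatePairingRecordsB.lean`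

Each record: `BSD(E,3)` for the named curve from `hGZK` + the displayed certificate binders (see the
module docstring for their status); the kernel decides `Δ ≠ 0`, Kraus minimality of Cremona's model and
the irreducibility witness of §2. NOTHING IS BOOKED by these theorems (referee R106.7; engines R-281(d)). -/
/-- **`BSD(E,3)` for `340186p1` from the CTP-on-Sel³ certificate shape** (`N = 340186`; Cremona model
`[1, 0, 0, -13183358, -18680240740]`; `3 ∤ N`: GOOD ORDINARY at `3`; `ρ̄_{E,3}` irreducible, NOT surjective, normaliser-of-split-Cartan
type `3Ns` — class X10b; analytic rank `0`; `#Ш_an = 9` (`ord₃ = 2`); census: T1 — the one flag-free OPEN X10b pair below 5·10⁵ (c₂ = c₁₁ = 3: no printed Heegner-index bound is sharp); census row "340186p1 OPEN"). Displayed binders: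
`hGZK`; `r_an = 0`, `ord₃ #Ш_an = 2` (Cremona / engines); `hcard` = the exact `3`-descent line
`dim_𝔽₃ Sel^(3)(E/ℚ) = 2` (two engines, T2-BATCH-G10); the pairing binders = the ctp-sel3/1.1 TARGET
document `ctp_cert_340186p1.json` of `HOME/b2b-bsdres-x10/g10/ctp-sel3/certs/` (route A's matrix `G = [0 −1; 1 0]`,
alternating, rank `2`; VERIFIER B UNREAD at the time of writing — R-281(d) queue; referee R106.7 governs
booking). Kernel-decided here: `Δ ≠ 0`, global minimality (Kraus), `E[3]` irreducible (`ℓ = 13`,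
`#Ẽ(𝔽_{13}) = 8`, `a_{13} = 6`). Per pair; books nothing.
[cite: Miller2011LMS, Def. 1.1] [cite: FisherNewton2014, Thm. 1.3] [cite: Cremona2006, Table 1 (Cremona label 340186p1)] -/
theorem bsdp_t340186p1 (hGZK : rank_eq_analyticRank_of_analyticRank_le_one)
    (W : WeierstrassCurve ℚ) (hW : W = ⟨1, 0, 0, -13183358, -18680240740⟩)
    (hr : W.analyticRank = 0) (hcard : Nat.card (W.selmerGroup (3 : ℤ)) = 9)
    {Q : Type*} [AddCommGroup Q] (B : W.sha →+ W.sha →+ Q) {x₁ x₂ : W.sha}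
    (hx₁ : 3 • x₁ = 0) (hx₂ : 3 • x₂ = 0)
    (h₁₁ : B x₁ x₁ = 0) (h₂₂ : B x₂ x₂ = 0) (h₁₂ : B x₁ x₂ ≠ 0) (h₂₁ : B x₂ x₁ ≠ 0)
    {q : ℚ} (hq : shaAn W = (q : ℂ)) (hv : padicValRat 3 q = 2) : BSDp W 3 := by
  subst hW
  have hE := isElliptic_of_discOf_ne_zero 1 0 0 (-13183358) (-18680240740) (by decide +kernel)
  have hM := isGloballyMinimal_of_krausCriterion_bounded₂ 1 0 0 (-13183358) (-18680240740) (by decide +kernel)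
    (by decide +kernel) (by decide +kernel)
  haveI : Fact (Nat.Prime 13) := ⟨by norm_num⟩
  exact @bsdp_three_of_ainvs_of_ctpGram hGZK 1 0 0 (-13183358) (-18680240740) _ hE hM
    (@integralModelInt_eq_of_map_eq _ hM _ (map_mk_int _ _ _ _ _)) 13 8 _ (by decide) (by decide +kernel)
    card_t340186p1_13 (by decide +kernel) hr hcard Q _ B x₁ x₂ hx₁ hx₂ h₁₁ h₂₂ h₁₂ h₂₁ q hq hv

/-- **`BSD(E,3)` for `10082b1` from the CTP-on-Sel³ certificate shape** (`N = 10082`; Cremona model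
`[1, 0, 1, -708366, -227675928]`; `3 ∤ N`: GOOD ORDINARY at `3`; `ρ̄_{E,3}` irreducible, NOT surjective, normaliser-of-split-Cartan
type `3Ns` — class X10b; analytic rank `0`; `#Ш_an = 9` (`ord₃ = 2`); census: Cha-certified under flag Miller11-Thm54-Cha-case). Displayed binders:
`hGZK`; `r_an = 0`, `ord₃ #Ш_an = 2` (Cremona / engines); `hcard` = the exact `3`-descent line
`dim_𝔽₃ Sel^(3)(E/ℚ) = 2` (two engines, T2-BATCH-G10); the pairing binders = the ctp-sel3/1.1 TARGET
document `ctp_cert_10082b1.json` of `HOME/b2b-bsdres-x10/g10/ctp-sel3/certs/` (route A's matrix `G = [0 1; −1 0]`,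
alternating, rank `2`; VERIFIER B UNREAD at the time of writing — R-281(d) queue; referee R106.7 governs
booking). Kernel-decided here: `Δ ≠ 0`, global minimality (Kraus), `E[3]` irreducible (`ℓ = 7`,
`#Ẽ(𝔽_{7}) = 5`, `a_{7} = 3`). Per pair; books nothing.
[cite: Miller2011LMS, Def. 1.1] [cite: FisherNewton2014, Thm. 1.3] [cite: Cremona2006, Table 1 (Cremona label 10082b1)] -/
theorem bsdp_t10082b1 (hGZK : rank_eq_analyticRank_of_analyticRank_le_one)
    (W : WeierstrassCurve ℚ) (hW : W = ⟨1, 0, 1, -708366, -227675928⟩)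
    (hr : W.analyticRank = 0) (hcard : Nat.card (W.selmerGroup (3 : ℤ)) = 9)
    {Q : Type*} [AddCommGroup Q] (B : W.sha →+ W.sha →+ Q) {x₁ x₂ : W.sha}
    (hx₁ : 3 • x₁ = 0) (hx₂ : 3 • x₂ = 0)
    (h₁₁ : B x₁ x₁ = 0) (h₂₂ : B x₂ x₂ = 0) (h₁₂ : B x₁ x₂ ≠ 0) (h₂₁ : B x₂ x₁ ≠ 0)
    {q : ℚ} (hq : shaAn W = (q : ℂ)) (hv : padicValRat 3 q = 2) : BSDp W 3 := by
  subst hW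
  have hE := isElliptic_of_discOf_ne_zero 1 0 1 (-708366) (-227675928) (by decide +kernel)
  have hM := isGloballyMinimal_of_krausCriterion_bounded₂ 1 0 1 (-708366) (-227675928) (by decide +kernel)
    (by decide +kernel) (by decide +kernel)
  haveI : Fact (Nat.Prime 7) := ⟨by norm_num⟩
  exact @bsdp_three_of_ainvs_of_ctpGram hGZK 1 0 1 (-708366) (-227675928) _ hE hM
    (@integralModelInt_eq_of_map_eq _ hM _ (map_mk_int _ _ _ _ _)) 7 5 _ (by decide) (by decide +kernel)
    card_t10082b1_7 (by decide +kernel) hr hcard Q _ B x₁ x₂ hx₁ hx₂ h₁₁ h₂₂ h₁₂ h₂₁ q hq hv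

/-- **`BSD(E,3)` for `40898d1` from the CTP-on-Sel³ certificate shape** (`N = 40898`; Cremona model
`[1, 0, 1, -7249597, -7544452368]`; `3 ∤ N`: GOOD ORDINARY at `3`; `ρ̄_{E,3}` irreducible, NOT surjective, normaliser-of-split-Cartan
type `3Ns` — class X10b; analytic rank `0`; `#Ш_an = 9` (`ord₃ = 2`); census: Cha-certified under flag). Displayed binders:
`hGZK`; `r_an = 0`, `ord₃ #Ш_an = 2` (Cremona / engines); `hcard` = the exact `3`-descent line
`dim_𝔽₃ Sel^(3)(E/ℚ) = 2` (two engines, T2-BATCH-G10); the pairing binders = the ctp-sel3/1.1 TARGET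
document `ctp_cert_40898d1.json` of `HOME/b2b-bsdres-x10/g10/ctp-sel3/certs/` (route A's matrix `G = [0 −1; 1 0]`,
alternating, rank `2`; VERIFIER B UNREAD at the time of writing — R-281(d) queue; referee R106.7 governs
booking). Kernel-decided here: `Δ ≠ 0`, global minimality (Kraus), `E[3]` irreducible (`ℓ = 31`,
`#Ẽ(𝔽_{31}) = 32`, `a_{31} = 0`). Per pair; books nothing.
[cite: Miller2011LMS, Def. 1.1] [cite: FisherNewton2014, Thm. 1.3] [cite: Cremona2006, Table 1 (Cremona label 40898d1)] -/
theorem bsdp_t40898d1 (hGZK : rank_eq_analyticRank_of_analyticRank_le_one)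
    (W : WeierstrassCurve ℚ) (hW : W = ⟨1, 0, 1, -7249597, -7544452368⟩)
    (hr : W.analyticRank = 0) (hcard : Nat.card (W.selmerGroup (3 : ℤ)) = 9)
    {Q : Type*} [AddCommGroup Q] (B : W.sha →+ W.sha →+ Q) {x₁ x₂ : W.sha}
    (hx₁ : 3 • x₁ = 0) (hx₂ : 3 • x₂ = 0)
    (h₁₁ : B x₁ x₁ = 0) (h₂₂ : B x₂ x₂ = 0) (h₁₂ : B x₁ x₂ ≠ 0) (h₂₁ : B x₂ x₁ ≠ 0)
    {q : ℚ} (hq : shaAn W = (q : ℂ)) (hv : padicValRat 3 q = 2) : BSDp W 3 := by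
  subst hW
  have hE := isElliptic_of_discOf_ne_zero 1 0 1 (-7249597) (-7544452368) (by decide +kernel)
  have hM := isGloballyMinimal_of_krausCriterion_bounded₂ 1 0 1 (-7249597) (-7544452368) (by decide +kernel)
    (by decide +kernel) (by decide +kernel)
  haveI : Fact (Nat.Prime 31) := ⟨by norm_num⟩
  exact @bsdp_three_of_ainvs_of_ctpGram hGZK 1 0 1 (-7249597) (-7544452368) _ hE hM
    (@integralModelInt_eq_of_map_eq _ hM _ (map_mk_int _ _ _ _ _)) 31 32 _ (by decide) (by decide +kernel)
    card_t40898d1_31 (by decide +kernel) hr hcard Q _ B x₁ x₂ hx₁ hx₂ h₁₁ h₂₂ h₁₂ h₂₁ q hq hv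

/-- **`BSD(E,3)` for `53966a1` from the CTP-on-Sel³ certificate shape** (`N = 53966`; Cremona model
`[1, 1, 0, -343191, -77988907]`; `3 ∤ N`: GOOD ORDINARY at `3`; `ρ̄_{E,3}` irreducible, NOT surjective, normaliser-of-split-Cartan
type `3Ns` — class X10b; analytic rank `0`; `#Ш_an = 9` (`ord₃ = 2`); census: Jetchev-closable (q = 223; p206000/p206319)). Displayed binders:
`hGZK`; `r_an = 0`, `ord₃ #Ш_an = 2` (Cremona / engines); `hcard` = the exact `3`-descent line
`dim_𝔽₃ Sel^(3)(E/ℚ) = 2` (two engines, T2-BATCH-G10); the pairing binders = the ctp-sel3/1.1 TARGET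
document `ctp_cert_53966a1.json` of `HOME/b2b-bsdres-x10/g10/ctp-sel3/certs/` (route A's matrix `G = [0 1; −1 0]`,
alternating, rank `2`; VERIFIER B UNREAD at the time of writing — R-281(d) queue; referee R106.7 governs
booking). Kernel-decided here: `Δ ≠ 0`, global minimality (Kraus), `E[3]` irreducible (`ℓ = 7`,
`#Ẽ(𝔽_{7}) = 5`, `a_{7} = 3`). Per pair; books nothing.
[cite: Miller2011LMS, Def. 1.1] [cite: FisherNewton2014, Thm. 1.3] [cite: Cremona2006, Table 1 (Cremona label 53966a1)] -/
theorem bsdp_t53966a1 (hGZK : rank_eq_analyticRank_of_analyticRank_le_one)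
    (W : WeierstrassCurve ℚ) (hW : W = ⟨1, 1, 0, -343191, -77988907⟩)
    (hr : W.analyticRank = 0) (hcard : Nat.card (W.selmerGroup (3 : ℤ)) = 9)
    {Q : Type*} [AddCommGroup Q] (B : W.sha →+ W.sha →+ Q) {x₁ x₂ : W.sha}
    (hx₁ : 3 • x₁ = 0) (hx₂ : 3 • x₂ = 0)
    (h₁₁ : B x₁ x₁ = 0) (h₂₂ : B x₂ x₂ = 0) (h₁₂ : B x₁ x₂ ≠ 0) (h₂₁ : B x₂ x₁ ≠ 0)
    {q : ℚ} (hq : shaAn W = (q : ℂ)) (hv : padicValRat 3 q = 2) : BSDp W 3 := by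
  subst hW
  have hE := isElliptic_of_discOf_ne_zero 1 1 0 (-343191) (-77988907) (by decide +kernel)
  have hM := isGloballyMinimal_of_krausCriterion_bounded₂ 1 1 0 (-343191) (-77988907) (by decide +kernel)
    (by decide +kernel) (by decide +kernel)
  haveI : Fact (Nat.Prime 7) := ⟨by norm_num⟩
  exact @bsdp_three_of_ainvs_of_ctpGram hGZK 1 1 0 (-343191) (-77988907) _ hE hM
    (@integralModelInt_eq_of_map_eq _ hM _ (map_mk_int _ _ _ _ _)) 7 5 _ (by decide) (by decide +kernel)
    card_t53966a1_7 (by decide +kernel) hr hcard Q _ B x₁ x₂ hx₁ hx₂ h₁₁ h₂₂ h₁₂ h₂₁ q hq hv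

/-- **`BSD(E,3)` for `55696l1` from the CTP-on-Sel³ certificate shape** (`N = 55696`; Cremona model
`[0, 1, 0, 9105136, -14983896556]`; `3 ∤ N`: GOOD ORDINARY at `3`; `ρ̄_{E,3}` irreducible, NOT surjective, normaliser-of-split-Cartan
type `3Ns` — class X10b; analytic rank `0`; `#Ш_an = 9` (`ord₃ = 2`); census: Cha-certified under flag). Displayed binders:
`hGZK`; `r_an = 0`, `ord₃ #Ш_an = 2` (Cremona / engines); `hcard` = the exact `3`-descent line
`dim_𝔽₃ Sel^(3)(E/ℚ) = 2` (two engines, T2-BATCH-G10); the pairing binders = the ctp-sel3/1.1 TARGET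
document `ctp_cert_55696l1.json` of `HOME/b2b-bsdres-x10/g10/ctp-sel3/certs/` (route A's matrix `G = [0 −1; 1 0]`,
alternating, rank `2`; VERIFIER B UNREAD at the time of writing — R-281(d) queue; referee R106.7 governs
booking). GLOBAL MINIMALITY of Cremona's model is a DISPLAYED HYPOTHESIS `hmin` for this record (additive at `2` with `2⁴ ∣ c₄`, `2⁶ ∥ c₆`:
outside the tree's bounded Kraus clauses F2a/F2c of `isGloballyMinimal_of_krausCriterion_bounded₂`; Kraus 1989 Prop. 2 in print). Kernel-decided here: `Δ ≠ 0`, `E[3]` irreducible (`ℓ = 13`,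
`#Ẽ(𝔽_{13}) = 8`, `a_{13} = 6`). Per pair; books nothing.
[cite: Miller2011LMS, Def. 1.1] [cite: FisherNewton2014, Thm. 1.3] [cite: Cremona2006, Table 1 (Cremona label 55696l1)] -/
theorem bsdp_t55696l1 (hGZK : rank_eq_analyticRank_of_analyticRank_le_one)
    (W : WeierstrassCurve ℚ) (hW : W = ⟨0, 1, 0, 9105136, -14983896556⟩) [hmin : W.IsGloballyMinimal]
    (hr : W.analyticRank = 0) (hcard : Nat.card (W.selmerGroup (3 : ℤ)) = 9)
    {Q : Type*} [AddCommGroup Q] (B : W.sha →+ W.sha →+ Q) {x₁ x₂ : W.sha}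
    (hx₁ : 3 • x₁ = 0) (hx₂ : 3 • x₂ = 0)
    (h₁₁ : B x₁ x₁ = 0) (h₂₂ : B x₂ x₂ = 0) (h₁₂ : B x₁ x₂ ≠ 0) (h₂₁ : B x₂ x₁ ≠ 0)
    {q : ℚ} (hq : shaAn W = (q : ℂ)) (hv : padicValRat 3 q = 2) : BSDp W 3 := by
  subst hW
  have hE := isElliptic_of_discOf_ne_zero 0 1 0 9105136 (-14983896556) (by decide +kernel)
  have hM := hmin
  haveI : Fact (Nat.Prime 13) := ⟨by norm_num⟩
  exact @bsdp_three_of_ainvs_of_ctpGram hGZK 0 1 0 9105136 (-14983896556) _ hE hM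
    (@integralModelInt_eq_of_map_eq _ hM _ (map_mk_int _ _ _ _ _)) 13 8 _ (by decide) (by decide +kernel)
    card_t55696l1_13 (by decide +kernel) hr hcard Q _ B x₁ x₂ hx₁ hx₂ h₁₁ h₂₂ h₁₂ h₂₁ q hq hv

/-- **`BSD(E,3)` for `55696n1` from the CTP-on-Sel³ certificate shape** (`N = 55696`; Cremona model
`[0, 1, 0, -2396088, -1642476716]`; `3 ∤ N`: GOOD ORDINARY at `3`; `ρ̄_{E,3}` irreducible, NOT surjective, normaliser-of-split-Cartan
type `3Ns` — class X10b; analytic rank `0`; `#Ш_an = 9` (`ord₃ = 2`); census: Cha-certified under flag). Displayed binders: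
`hGZK`; `r_an = 0`, `ord₃ #Ш_an = 2` (Cremona / engines); `hcard` = the exact `3`-descent line
`dim_𝔽₃ Sel^(3)(E/ℚ) = 2` (two engines, T2-BATCH-G10); the pairing binders = the ctp-sel3/1.1 TARGET
document `ctp_cert_55696n1.json` of `HOME/b2b-bsdres-x10/g10/ctp-sel3/certs/` (route A's matrix `G = [0 −1; 1 0]`,
alternating, rank `2`; VERIFIER B UNREAD at the time of writing — R-281(d) queue; referee R106.7 governs
booking). GLOBAL MINIMALITY of Cremona's model is a DISPLAYED HYPOTHESIS `hmin` for this record (additive at `2` with `2⁴ ∣ c₄`, `2⁶ ∥ c₆`: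
outside the tree's bounded Kraus clauses F2a/F2c of `isGloballyMinimal_of_krausCriterion_bounded₂`; Kraus 1989 Prop. 2 in print). Kernel-decided here: `Δ ≠ 0`, `E[3]` irreducible (`ℓ = 13`,
`#Ẽ(𝔽_{13}) = 11`, `a_{13} = 3`). Per pair; books nothing.
[cite: Miller2011LMS, Def. 1.1] [cite: FisherNewton2014, Thm. 1.3] [cite: Cremona2006, Table 1 (Cremona label 55696n1)] -/
theorem bsdp_t55696n1 (hGZK : rank_eq_analyticRank_of_analyticRank_le_one)
    (W : WeierstrassCurve ℚ) (hW : W = ⟨0, 1, 0, -2396088, -1642476716⟩) [hmin : W.IsGloballyMinimal]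
    (hr : W.analyticRank = 0) (hcard : Nat.card (W.selmerGroup (3 : ℤ)) = 9)
    {Q : Type*} [AddCommGroup Q] (B : W.sha →+ W.sha →+ Q) {x₁ x₂ : W.sha}
    (hx₁ : 3 • x₁ = 0) (hx₂ : 3 • x₂ = 0)
    (h₁₁ : B x₁ x₁ = 0) (h₂₂ : B x₂ x₂ = 0) (h₁₂ : B x₁ x₂ ≠ 0) (h₂₁ : B x₂ x₁ ≠ 0)
    {q : ℚ} (hq : shaAn W = (q : ℂ)) (hv : padicValRat 3 q = 2) : BSDp W 3 := by
  subst hW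
  have hE := isElliptic_of_discOf_ne_zero 0 1 0 (-2396088) (-1642476716) (by decide +kernel)
  have hM := hmin
  haveI : Fact (Nat.Prime 13) := ⟨by norm_num⟩
  exact @bsdp_three_of_ainvs_of_ctpGram hGZK 0 1 0 (-2396088) (-1642476716) _ hE hM
    (@integralModelInt_eq_of_map_eq _ hM _ (map_mk_int _ _ _ _ _)) 13 11 _ (by decide) (by decide +kernel)
    card_t55696n1_13 (by decide +kernel) hr hcard Q _ B x₁ x₂ hx₁ hx₂ h₁₁ h₂₂ h₁₂ h₂₁ q hq hv

/-- **`340186p1`: the exact `3`-part `ord₃ #Ш(E/ℚ) = 2` (`#Ш[3^∞] = 9`) from the same binders WITHOUT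
the analytic `Ш` value** — the shape in which the certificate reaches the census row. Books nothing.
[cite: FisherNewton2014, Thm. 1.3] [cite: Cremona2006, Table 1 (Cremona label 340186p1)] -/
theorem padicValNat_shaOrder_t340186p1 (hGZK : rank_eq_analyticRank_of_analyticRank_le_one)
    (W : WeierstrassCurve ℚ) (hW : W = ⟨1, 0, 0, -13183358, -18680240740⟩)
    (hr : W.analyticRank = 0) (hcard : Nat.card (W.selmerGroup (3 : ℤ)) = 9)
    {Q : Type*} [AddCommGroup Q] (B : W.sha →+ W.sha →+ Q) {x₁ x₂ : W.sha}
    (hx₁ : 3 • x₁ = 0) (hx₂ : 3 • x₂ = 0)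
    (h₁₁ : B x₁ x₁ = 0) (h₂₂ : B x₂ x₂ = 0) (h₁₂ : B x₁ x₂ ≠ 0) (h₂₁ : B x₂ x₁ ≠ 0) :
    padicValNat 3 W.shaOrder = 2 := by
  subst hW
  have hE := isElliptic_of_discOf_ne_zero 1 0 0 (-13183358) (-18680240740) (by decide +kernel)
  have hM := isGloballyMinimal_of_krausCriterion_bounded₂ 1 0 0 (-13183358) (-18680240740) (by decide +kernel)
    (by decide +kernel) (by decide +kernel)
  haveI : Fact (Nat.Prime 13) := ⟨by norm_num⟩
  exact @padicValNat_shaOrder_three_eq_two_of_ainvs_of_ctpGram hGZK 1 0 0 (-13183358) (-18680240740) _ hE hM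
    (@integralModelInt_eq_of_map_eq _ hM _ (map_mk_int _ _ _ _ _)) 13 8 _ (by decide) (by decide +kernel)
    card_t340186p1_13 (by decide +kernel) hr hcard Q _ B x₁ x₂ hx₁ hx₂ h₁₁ h₂₂ h₁₂ h₂₁

end Summit.BirchSwinnertonDyer.Rank1Residual.X10

end
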